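import Literature.NumberTheory.Sieve.FouvryTenenbaumDivisorAPTuple
import Literature.NumberTheory.Sieve.FouvryTenenbaumDivisorAPWeilProofs
import HarnessLib

/-!
# Fouvry–Tenenbaum 2021, Lemmas 4.12–4.13: the trivial range and the Weil range, PROVED

Topic `Literature/NumberTheory/Sieve`; theorems only (no definition, no named fact).  Sibling proofs file
of `FouvryTenenbaumDivisorAP.lean`, whose named facts `FouvryTenenbaum2021_lemma412/413` are É. Fouvry,
G. Tenenbaum, *Multiplicative functions in large arithmetic progressions and applications*, Trans. Amer.
Math. Soc. 375 (2022) 245–299, Lemmas 4.12–4.13, (4.16)/(4.18) (PDF p. 19): `τ₂`/`τ₃` in arithmetic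
progressions to the levels `x^{3/5}`, `x^{1/2+1/85}`, unit classes `mod D` on each variable, bound
`C D^{C₀} x^{1−δ}/φ(s)`; of `FouvryTenenbaumDivisorAPTuple.lean` (tuple form `DivisorAPTuple k θ`,
one-variable count `abs_sum_apBox_gAP_le`: `|∑_{A<n≤B, n≡t (D)} g_s(n; a)| ≤ 1 + τ(s)/φ(s)`); and of
`FouvryTenenbaumDivisorAPWeilProofs.lean` (the discharge `FouvryTenenbaum2021_lemma412_holds`, through the
completion estimate `lemma412_core` — Weil's bound for Kloosterman sums, PROVED in the tree).

## Part 1 — the bottom layer of the printed proof (trivial range)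

The first step of any proof of (4.16)/(4.18) disposes of the small moduli by the trivial count in the
LAST variable; this is proved unconditionally and with explicit constants:

* `gAP_mul_left_of_coprime`, `gAP_mul_left_eq_zero` — `g_s(kn; a) = g_s(n; b)` for `(k, s) = 1`,
  `bk ≡ a (mod s)`, and `g_s(kn; a) = 0` for `(k, s) > 1`, `(s, a) = 1`;
* `abs_sum_apBox_gAP_mul_le` — `|∑_{A<n≤B, n≡t (D)} g_s(kn; a)| ≤ 1 + τ(s)/φ(s)` for EVERY `k`
  (`(D, s) = (a, s) = 1`);
* `card_apBox_le_two_mul` — `#{⌊lo⌋ < m ≤ ⌊hi⌋ : m ≡ t (D)} ≤ 2M` for `1 ≤ M ≤ lo`, `hi ≤ 2M`;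
* `prod_le_rpow_of_le_last`, `mul_le_rpow_two_thirds` — `∏ᵢ Mᵢ ≤ x^{k/(k+1)}` when every `Mᵢ ≤ M_ℓ`
  and `(∏ᵢ Mᵢ) M_ℓ ≤ x` (the last box is the longest);
* **`divisorAPTuple_of_lt`** — `DivisorAPTuple k θ` for every `θ < 1/(k+1)`, with `δ = 1/(k+1) − θ`,
  `C₀ = 0`, `C = 2^{k+1}`:  `|∑| ≤ (∏ᵢ #boxᵢ)(1 + τ(s)/φ(s)) ≤ 2^k x^{k/(k+1)} · 2s/φ(s) ≤ 2^{k+1} x^{k/(k+1)+θ}/φ(s)`;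
* **`FouvryTenenbaum2021_lemma413_smallLevel`** — the statement of `FouvryTenenbaum2021_lemma413`
  VERBATIM with the level `x^{1/2+1/85}` replaced by `x^θ`, any `θ < 1/3` (`δ = 1/3 − θ`, `C₀ = 0`,
  `C = 8`), and `FouvryTenenbaum2021_lemma412_smallLevel` likewise (`θ < 1/2`, `C = 4`).

## Part 2 — the Weil range (from `lemma412_core`)

* **`FouvryTenenbaum2021_lemma412_of_lt`** — the statement of the named fact `FouvryTenenbaum2021_lemma412`
  with `x^{3/5}` replaced by `x^θ`, for EVERY `θ < 2/3`: the printed generality of (4.16) ("for each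
  `ε > 0` … `1 ≤ q ≤ x^{2/3−ε}`"), of which the named fact is the case `ε = 1/15`;
* `abs_sum_apBox3_gAP_le` — three variables: `|∑_{m₁,m₂,m₃} g_s(m₁m₂m₃; a)| ≤ #box₁ · (the bound of
  lemma412_core in (m₂, m₃))`, by `g_s(m₁m₂m₃; a) = g_s(m₂m₃; a m̄₁)` for `(m₁, s) = 1` (else `0`);
* **`FouvryTenenbaum2021_lemma413_of_lt`** — the statement of `FouvryTenenbaum2021_lemma413` VERBATIM with
  the level `x^{1/2+1/85}` replaced by `x^θ`, for every `θ < 4/9` (supersedes the `θ < 1/3` of Part 1):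
  `|∑| ≤ 2M₁ τ(s)(1 + log s)(6M₂/φ(s) + τ(s)√s(1 + log s)) ≤ C (x^{2/3+2η} + x^{1/3} s^{3/2+4η})/φ(s)`,
  and `s^{3/2} ≤ x^{2/3−}` is exactly `θ < 4/9` in the critical case `M₁ ≈ x^{1/3}`.
  (`card_divisors_mul_log_le`, `core_bracket_le`, `rpow_mul_totient_le` are the shared endgame steps.)
* `divisorAPTuple_one_of_lt` (`θ < 2/3`), `divisorAPTuple_one_holds` (`θ = 3/5`), `divisorAPTuple_two_of_lt`
  (`θ < 4/9`) — the same in the tuple vocabulary `DivisorAPTuple k θ` of the consumers, unconditionally.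

## What is NOT proved, and why (triage of `FouvryTenenbaum2021_lemma413`)

In the complementary range `x^{4/9} ≤ s ≤ x^{1/2+1/85}`, (4.18) is D. R. Heath-Brown, *The divisor
function `d₃(n)` in arithmetic progressions*, Acta Arith. 47 (1986) 29–56, Thm 1 (box form `N(U, V, W)`,
§2), re-run with additive characters `mod D` (FT, p. 20: "standard"); its principal estimate (§4) rests
on Smith's bound `|K₂(a; q)| ≤ q (a, q) d₃(q)` for the hyper-Kloosterman sum ((3.1)) and on
Birch–Bombieri's bound `|S'| ≤ c₁ p^{3/2}` for the complete sum `∑*_{x,y,X,Y (p), αx̄ȳ+βX̄Ȳ≡1} e_p(x+y+X+Y)`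
(Friedlander–Iwaniec, Ann. of Math. 121 (1985), appendix), both consequences of Deligne's theorems —
absent from Mathlib and from `Literature/`.  Weil's bound alone (Part 2) stops at `x^{4/9}` when
`M₁ ≈ M₂ ≈ M₃ ≈ x^{1/3}`; Heath-Brown's first auxiliary estimate (§5) is of the same Weil type (p. 32).

## References

* É. Fouvry, G. Tenenbaum, Trans. Amer. Math. Soc. 375 (2022), Lemmas 4.12–4.13, pp. 19–20. [FouvryTenenbaum2021]
* D. R. Heath-Brown, Acta Arith. 47 (1986) 29–56, Thm 1, §§2–5 (doi:10.4064/aa-47-1-29-56).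
-/

open Finset Fintype Real
open scoped ArithmeticFunction.sigma

noncomputable section

namespace Literature.NumberTheory.Sieve

namespace FouvryTenenbaum2021

/-! ### The weight `g_s(kn; a)` as a function of the last variable -/

/-- `g_s(kn; a) = g_s(n; b)` whenever `(k, s) = 1` and `b ≡ a k̄ (mod s)`: both indicators only see
`n mod s`, and `(kn, s) = (n, s)`. [folklore] -/
theorem gAP_mul_left_of_coprime {s k : ℕ} (hk : k.Coprime s) {a b : ℤ}
    (hb : (b : ZMod s) = (a : ZMod s) * ((k : ZMod s))⁻¹) (n : ℕ) :
    gAP s a (k * n) = gAP s b n := by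
  unfold gAP
  have hunit : (k : ZMod s) * ((k : ZMod s))⁻¹ = 1 := ZMod.coe_mul_inv_eq_one k hk
  have h1 : (((k * n : ℕ) : ZMod s) = (a : ZMod s)) ↔ ((n : ZMod s) = (b : ZMod s)) := by
    rw [Nat.cast_mul, hb]
    constructor
    · intro h
      rw [← h, mul_comm (k : ZMod s) (n : ZMod s), mul_assoc, hunit, mul_one]
    · intro h
      rw [h, mul_left_comm, hunit, mul_one]
  have h2 : (k * n).Coprime s ↔ n.Coprime s := by
    rw [Nat.coprime_mul_iff_left]
    exact ⟨fun h => h.2, fun h => ⟨hk, h⟩⟩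
  simp only [h1, h2]

/-- `g_s(kn; a) = 0` whenever `(k, s) > 1` and `(s, a) = 1`: `kn ≡ a (mod s)` would make `k` a unit
`mod s`, and `(kn, s) > 1`. [folklore] -/
theorem gAP_mul_left_eq_zero {s k : ℕ} (hk : ¬ k.Coprime s) {a : ℤ} (ha : IsCoprime (s : ℤ) a)
    (n : ℕ) : gAP s a (k * n) = 0 := by
  unfold gAP
  have h1 : ((k * n : ℕ) : ZMod s) ≠ (a : ZMod s) := by
    intro h
    have hu : IsUnit ((a : ℤ) : ZMod s) := (ZMod.coe_int_isUnit_iff_isCoprime a s).2 ha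
    rw [← h, Nat.cast_mul] at hu
    exact hk ((ZMod.isUnit_iff_coprime k s).1 (isUnit_of_mul_isUnit_left hu))
  have h2 : ¬ (k * n).Coprime s := fun h => hk (Nat.Coprime.coprime_mul_right h)
  rw [if_neg h1, if_neg h2, zero_div, sub_zero]

/-- **The count in the last variable, with a unit or non-unit cofactor**: for `s, D ≥ 1`, `(D, s) = 1`,
`(s, a) = 1` and ANY `k`, `|∑_{A < n ≤ B, n ≡ t (D)} g_s(kn; a)| ≤ 1 + τ(s)/φ(s)` (the tree's
`abs_sum_apBox_gAP_le` in the class `a k̄` when `(k, s) = 1`; an empty sum otherwise). [folklore] -/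
theorem abs_sum_apBox_gAP_mul_le {s D : ℕ} (hs : 0 < s) (hD : 0 < D) (hDs : D.Coprime s) {a : ℤ}
    (ha : IsCoprime (s : ℤ) a) (k : ℕ) (t : ℤ) (A B : ℕ) :
    |∑ n ∈ (Ioc A B).filter (fun m : ℕ => (m : ZMod D) = (t : ZMod D)), gAP s a (k * n)| ≤
      1 + (σ 0 s : ℝ) / (Nat.totient s : ℝ) := by
  by_cases hk : k.Coprime s
  · haveI : NeZero s := ⟨hs.ne'⟩
    set b : ℤ := ((((a : ZMod s) * ((k : ZMod s))⁻¹).val : ℕ) : ℤ)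
    have hb : (b : ZMod s) = (a : ZMod s) * ((k : ZMod s))⁻¹ := by
      simp only [b, Int.cast_natCast, ZMod.natCast_zmod_val]
    rw [Finset.sum_congr rfl (fun n _ => gAP_mul_left_of_coprime hk hb n)]
    exact abs_sum_apBox_gAP_le hs hD hDs b t A B
  · rw [Finset.sum_congr rfl (fun n _ => gAP_mul_left_eq_zero hk ha n), Finset.sum_const_zero, abs_zero]
    positivity

/-! ### Sizes of the boxes -/

/-- A sub-interval of `]M, 2M]` in a class `mod D` has at most `2M` integers when `M ≥ 1`:
`#{⌊lo⌋ < m ≤ ⌊hi⌋} = ⌊hi⌋ − ⌊lo⌋ ≤ hi − (lo − 1) ≤ M + 1 ≤ 2M`. [folklore] -/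
theorem card_apBox_le_two_mul {M lo hi : ℝ} (hM : 1 ≤ M) (hlo : M ≤ lo) (hhi : hi ≤ 2 * M) (D : ℕ)
    (t : ℤ) :
    ((((Ioc ⌊lo⌋₊ ⌊hi⌋₊).filter (fun m : ℕ => (m : ZMod D) = (t : ZMod D))).card : ℕ) : ℝ) ≤ 2 * M := by
  have h1 : ((Ioc ⌊lo⌋₊ ⌊hi⌋₊).filter (fun m : ℕ => (m : ZMod D) = (t : ZMod D))).card ≤ ⌊hi⌋₊ - ⌊lo⌋₊ :=
    (Finset.card_filter_le _ _).trans (Nat.card_Ioc _ _).le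
  rcases le_or_gt ⌊hi⌋₊ ⌊lo⌋₊ with hle | hlt
  · rw [Nat.sub_eq_zero_of_le hle, Nat.le_zero] at h1
    rw [h1, Nat.cast_zero]
    linarith
  · have hhi0 : 0 ≤ hi := zero_le_one.trans (Nat.floor_pos.1 (lt_of_le_of_lt (Nat.zero_le _) hlt))
    have h2 : ((((Ioc ⌊lo⌋₊ ⌊hi⌋₊).filter (fun m : ℕ => (m : ZMod D) = (t : ZMod D))).card : ℕ) : ℝ) ≤
        (⌊hi⌋₊ : ℝ) - (⌊lo⌋₊ : ℝ) := by
      have := (Nat.cast_le (α := ℝ)).2 h1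
      rwa [Nat.cast_sub hlt.le] at this
    have h3 : (⌊hi⌋₊ : ℝ) ≤ hi := Nat.floor_le hhi0
    have h4 : lo < (⌊lo⌋₊ : ℝ) + 1 := Nat.lt_floor_add_one lo
    linarith

/-- The initial boxes are short: `∏ᵢ Mᵢ ≤ x^{k/(k+1)}` when `0 ≤ Mᵢ ≤ M_ℓ` for all `i < k` and
`(∏ᵢ Mᵢ) M_ℓ ≤ x` (`P ≤ M_ℓ^k`, so `P^{k+1} ≤ (P M_ℓ)^k ≤ x^k`). [folklore] -/
theorem prod_le_rpow_of_le_last {k : ℕ} {M : Fin k → ℝ} {Ml x : ℝ} (h0 : ∀ i, 0 ≤ M i)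
    (hMl : ∀ i, M i ≤ Ml) (hx : 0 ≤ x) (hprod : (∏ i, M i) * Ml ≤ x) :
    ∏ i, M i ≤ x ^ ((k : ℝ) / (k + 1)) := by
  have hP0 : 0 ≤ ∏ i, M i := Finset.prod_nonneg fun i _ => h0 i
  have hPMl : ∏ i, M i ≤ Ml ^ k := by
    calc ∏ i, M i ≤ ∏ _i : Fin k, Ml := Finset.prod_le_prod (fun i _ => h0 i) (fun i _ => hMl i)
      _ = Ml ^ k := by rw [Finset.prod_const, Finset.card_univ, Fintype.card_fin]
  have hpow : (∏ i, M i) ^ (k + 1) ≤ x ^ k := by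
    rcases Nat.eq_zero_or_pos k with rfl | hk
    · simp
    · have hMl0 : 0 ≤ Ml := (h0 ⟨0, hk⟩).trans (hMl ⟨0, hk⟩)
      calc (∏ i, M i) ^ (k + 1) = (∏ i, M i) ^ k * ∏ i, M i := pow_succ _ k
        _ ≤ (∏ i, M i) ^ k * Ml ^ k := mul_le_mul_of_nonneg_left hPMl (pow_nonneg hP0 k)
        _ = ((∏ i, M i) * Ml) ^ k := (mul_pow _ Ml k).symm
        _ ≤ x ^ k := pow_le_pow_left₀ (mul_nonneg hP0 hMl0) hprod k
  calc ∏ i, M i = ((∏ i, M i) ^ (k + 1)) ^ (((k + 1 : ℕ) : ℝ)⁻¹) :=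
      (Real.pow_rpow_inv_natCast hP0 (Nat.succ_ne_zero k)).symm
    _ ≤ (x ^ k) ^ (((k + 1 : ℕ) : ℝ)⁻¹) := Real.rpow_le_rpow (pow_nonneg hP0 _) hpow (by positivity)
    _ = x ^ ((k : ℝ) / (k + 1)) := by
      rw [← Real.rpow_natCast x k, ← Real.rpow_mul hx]
      congr 1
      push_cast
      ring

/-- Three variables: `M₁M₂ ≤ x^{2/3}` when `0 ≤ M₁, M₂ ≤ M₃` and `M₁M₂M₃ ≤ x`
(`(M₁M₂)³ ≤ (M₁M₂M₃)² ≤ x²`). [folklore] -/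
theorem mul_le_rpow_two_thirds {M₁ M₂ M₃ x : ℝ} (h1 : 0 ≤ M₁) (h2 : 0 ≤ M₂) (h13 : M₁ ≤ M₃)
    (h23 : M₂ ≤ M₃) (hx : 0 ≤ x) (hprod : M₁ * M₂ * M₃ ≤ x) : M₁ * M₂ ≤ x ^ (2 / 3 : ℝ) := by
  have hM3 : 0 ≤ M₃ := h1.trans h13
  have hA : M₁ * M₂ ≤ M₃ * M₃ := mul_le_mul h13 h23 h2 hM3
  have hP0 : 0 ≤ M₁ * M₂ := mul_nonneg h1 h2
  have h30 : 0 ≤ M₁ * M₂ * M₃ := mul_nonneg hP0 hM3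
  have hcube : (M₁ * M₂) ^ 3 ≤ x ^ 2 := by
    calc (M₁ * M₂) ^ 3 = (M₁ * M₂) ^ 2 * (M₁ * M₂) := by ring
      _ ≤ (M₁ * M₂) ^ 2 * (M₃ * M₃) := mul_le_mul_of_nonneg_left hA (pow_nonneg hP0 2)
      _ = (M₁ * M₂ * M₃) ^ 2 := by ring
      _ ≤ x ^ 2 := pow_le_pow_left₀ h30 hprod 2
  calc M₁ * M₂ = ((M₁ * M₂) ^ 3) ^ (((3 : ℕ) : ℝ)⁻¹) :=
      (Real.pow_rpow_inv_natCast hP0 (by norm_num)).symm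
    _ ≤ (x ^ 2) ^ (((3 : ℕ) : ℝ)⁻¹) := Real.rpow_le_rpow (pow_nonneg hP0 _) hcube (by positivity)
    _ = x ^ (2 / 3 : ℝ) := by
      rw [← Real.rpow_natCast x 2, ← Real.rpow_mul hx]
      norm_num

/-- `(D, s) = 1` from `(s, aD) = 1`. [folklore] -/
theorem coprime_of_isCoprime_mul {s D : ℕ} {a : ℤ} (hsa : IsCoprime (s : ℤ) (a * D)) : D.Coprime s := by
  have h1 : IsCoprime (s : ℤ) (D : ℤ) := hsa.of_mul_right_right
  rw [Int.isCoprime_iff_gcd_eq_one, Int.gcd_natCast_natCast] at h1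
  exact Nat.Coprime.symm h1

/-- `1 + τ(s)/φ(s) ≤ 2 x^θ/φ(s)` for `1 ≤ s ≤ x^θ` (`φ(s) + τ(s) ≤ 2s`). [folklore] -/
theorem one_add_card_divisors_div_totient_le {s : ℕ} (hs : 0 < s) {x θ : ℝ} (hsx : (s : ℝ) ≤ x ^ θ) :
    1 + (σ 0 s : ℝ) / (Nat.totient s : ℝ) ≤ 2 * x ^ θ / (Nat.totient s : ℝ) := by
  have hφ : (0 : ℝ) < Nat.totient s := by exact_mod_cast Nat.totient_pos.2 hs
  have hφs : (Nat.totient s : ℝ) ≤ s := by exact_mod_cast Nat.totient_le s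
  have hτs : (σ 0 s : ℝ) ≤ s := by
    rw [ArithmeticFunction.sigma_zero_apply]
    exact_mod_cast Nat.card_divisors_le_self s
  rw [show 1 + (σ 0 s : ℝ) / (Nat.totient s : ℝ) = ((Nat.totient s : ℝ) + σ 0 s) / (Nat.totient s : ℝ) by
    field_simp]
  apply div_le_div_of_nonneg_right _ hφ.le
  linarith

/-! ### The tuple form below level `x^{1/(k+1)}` -/

/-- **Fouvry–Tenenbaum's Lemmas 4.12/4.13 in tuple form, trivial range**: `DivisorAPTuple k θ` holds
unconditionally for every `θ < 1/(k+1)`, with `δ = 1/(k+1) − θ`, `C₀ = 0`, `C = 2^{k+1}`: by the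
triangle inequality over the `k` initial variables and the one-variable count in the last one,
`|∑| ≤ (∏ᵢ #boxᵢ)(1 + τ(s)/φ(s)) ≤ 2^k x^{k/(k+1)} · 2x^θ/φ(s) = 2^{k+1} x^{1−δ}/φ(s)`.
(For `k = 0` compare `divisorAPTuple_zero`; for `k = 1, 2` the genuine content of Lemmas 4.12/4.13 —
Weil's, resp. Deligne's bounds — is the complementary range `θ ≥ 1/2`, resp. `θ ≥ 1/3`.)
[cite: FouvryTenenbaum2021, Lemmas 4.12–4.13 (trivial range)] -/
theorem divisorAPTuple_of_lt {k : ℕ} {θ : ℝ} (hθ : θ < 1 / (k + 1)) : DivisorAPTuple k θ := by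
  refine ⟨1 / (k + 1) - θ, 0, 2 ^ (k + 1), by linarith, le_rfl, by positivity,
    fun x hx M lo hi Ml lol hil _ hMl hM1 _ hprod hlo hhi _ _ s D a t tl hs hsx hD hsa _ _ => ?_⟩
  have hx0 : 0 ≤ x := by linarith
  have hs0 : 0 < s := hs
  have hD0 : 0 < D := hD
  have hφ : (0 : ℝ) < Nat.totient s := by exact_mod_cast Nat.totient_pos.2 hs0
  have hDs : D.Coprime s := coprime_of_isCoprime_mul hsa
  have hsa' : IsCoprime (s : ℤ) a := hsa.of_mul_right_left
  have hx1 : (1 : ℝ) ≤ x ^ (1 / 100 : ℝ) := Real.one_le_rpow hx (by norm_num)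
  have hMone : ∀ i, 1 ≤ M i := fun i => hx1.trans (hM1 i)
  set B := piFinset (fun i => apBox (lo i) (hi i) D (t i))
  -- Step 1: triangle inequality over the initial variables, count in the last one
  have hinner : ∀ m ∈ B, |∑ n ∈ apBox lol hil D tl, gAP s a ((∏ i, m i) * n)| ≤
      1 + (σ 0 s : ℝ) / (Nat.totient s : ℝ) := fun m _ =>
    abs_sum_apBox_gAP_mul_le hs0 hD0 hDs hsa' (∏ i, m i) tl ⌊lol⌋₊ ⌊hil⌋₊
  have hsum : |∑ m ∈ B, ∑ n ∈ apBox lol hil D tl, gAP s a ((∏ i, m i) * n)| ≤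
      (B.card : ℝ) * (1 + (σ 0 s : ℝ) / (Nat.totient s : ℝ)) := by
    calc _ ≤ ∑ m ∈ B, |∑ n ∈ apBox lol hil D tl, gAP s a ((∏ i, m i) * n)| :=
          Finset.abs_sum_le_sum_abs _ _
      _ ≤ ∑ _m ∈ B, (1 + (σ 0 s : ℝ) / (Nat.totient s : ℝ)) := Finset.sum_le_sum hinner
      _ = (B.card : ℝ) * (1 + (σ 0 s : ℝ) / (Nat.totient s : ℝ)) := by
          rw [Finset.sum_const, nsmul_eq_mul]
  -- Step 2: the number of initial tuples
  have hcard : (B.card : ℝ) ≤ 2 ^ k * ∏ i, M i := by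
    have hB : B.card = ∏ i, (apBox (lo i) (hi i) D (t i)).card := Fintype.card_piFinset _
    rw [hB, Nat.cast_prod]
    calc ∏ i, (((apBox (lo i) (hi i) D (t i)).card : ℕ) : ℝ) ≤ ∏ i, (2 * M i) :=
          Finset.prod_le_prod (fun i _ => by positivity)
            (fun i _ => card_apBox_le_two_mul (hMone i) (hlo i) (hhi i) D (t i))
      _ = 2 ^ k * ∏ i, M i := by
          rw [Finset.prod_mul_distrib, Finset.prod_const, Finset.card_univ, Fintype.card_fin]
  -- Step 3: the initial boxes are short, the modulus is small
  have hP : ∏ i, M i ≤ x ^ ((k : ℝ) / (k + 1)) :=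
    prod_le_rpow_of_le_last (fun i => zero_le_one.trans (hMone i)) hMl hx0 hprod
  have hτφ := one_add_card_divisors_div_totient_le hs0 hsx
  have hk1 : (k : ℝ) + 1 ≠ 0 := by positivity
  have hexp : x ^ ((k : ℝ) / (k + 1)) * x ^ θ = x ^ (1 - (1 / (k + 1) - θ)) := by
    rw [← Real.rpow_add (by linarith)]
    congr 1
    field_simp
    ring
  -- Step 4: assemble
  rw [Real.rpow_zero, mul_one]
  calc |∑ m ∈ B, ∑ n ∈ apBox lol hil D tl, gAP s a ((∏ i, m i) * n)|
      ≤ (B.card : ℝ) * (1 + (σ 0 s : ℝ) / (Nat.totient s : ℝ)) := hsum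
    _ ≤ (2 ^ k * x ^ ((k : ℝ) / (k + 1))) * (2 * x ^ θ / (Nat.totient s : ℝ)) := by
        have h1 : (B.card : ℝ) ≤ 2 ^ k * x ^ ((k : ℝ) / (k + 1)) :=
          hcard.trans (mul_le_mul_of_nonneg_left hP (by positivity))
        exact mul_le_mul h1 hτφ (by positivity) (by positivity)
    _ = 2 ^ (k + 1) * x ^ (1 - (1 / (k + 1) - θ)) / (Nat.totient s : ℝ) := by
        rw [← hexp]
        ring

end FouvryTenenbaum2021

/-! ### Lemma 4.13, resp. 4.12, verbatim below level `x^{1/3}`, resp. `x^{1/2}` -/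

open FouvryTenenbaum2021

/-- **Lemma 4.13 ((4.18)) in the trivial range**: the statement of the named fact
`FouvryTenenbaum2021_lemma413` verbatim, the level `x^{1/2+1/85}` being replaced by `x^θ` for an
arbitrary `θ < 1/3` — unconditionally, with `δ = 1/3 − θ`, `C₀ = 0`, `C = 8`:
`|∑_{m₁,m₂,m₃}| ≤ #box₁ · #box₂ · (1 + τ(s)/φ(s)) ≤ 4 M₁M₂ · 2s/φ(s) ≤ 8 x^{2/3+θ}/φ(s)`.
The range `x^{1/3} ≤ s ≤ x^{1/2+1/85}` is Heath-Brown's theorem (Deligne's bounds) and is NOT proved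
in the tree. [cite: FouvryTenenbaum2021, Lemma 4.13 (trivial range)] -/
theorem FouvryTenenbaum2021_lemma413_smallLevel {θ : ℝ} (hθ : θ < 1 / 3) :
    ∃ δ C₀ C : ℝ, 0 < δ ∧ ∀ x : ℝ, 1 ≤ x → ∀ M₁ M₂ M₃ lo₁ hi₁ lo₂ hi₂ lo₃ hi₃ : ℝ,
      x ^ (1 / 100 : ℝ) ≤ M₁ → M₁ ≤ M₂ → M₂ ≤ M₃ → M₁ * M₂ * M₃ ≤ x →
      M₁ ≤ lo₁ → hi₁ ≤ 2 * M₁ → M₂ ≤ lo₂ → hi₂ ≤ 2 * M₂ → M₃ ≤ lo₃ → hi₃ ≤ 2 * M₃ →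
      ∀ (s D : ℕ) (a t₁ t₂ t₃ : ℤ), 1 ≤ s → (s : ℝ) ≤ x ^ θ → 1 ≤ D →
        IsCoprime (s : ℤ) (a * D) → IsCoprime (t₁ * t₂ * t₃) (D : ℤ) →
        |∑ m₁ ∈ (Ioc ⌊lo₁⌋₊ ⌊hi₁⌋₊).filter (fun m : ℕ => (m : ZMod D) = (t₁ : ZMod D)),
            ∑ m₂ ∈ (Ioc ⌊lo₂⌋₊ ⌊hi₂⌋₊).filter (fun m : ℕ => (m : ZMod D) = (t₂ : ZMod D)),
              ∑ m₃ ∈ (Ioc ⌊lo₃⌋₊ ⌊hi₃⌋₊).filter (fun m : ℕ => (m : ZMod D) = (t₃ : ZMod D)),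
                gAP s a (m₁ * m₂ * m₃)| ≤
          C * (D : ℝ) ^ C₀ * x ^ (1 - δ) / (Nat.totient s : ℝ) := by
  refine ⟨1 / 3 - θ, 0, 8, by linarith, fun x hx M₁ M₂ M₃ lo₁ hi₁ lo₂ hi₂ lo₃ hi₃ hM₁ h12 h23 hprod
    hlo₁ hhi₁ hlo₂ hhi₂ _ _ s D a t₁ t₂ t₃ hs hsx hD hsa _ => ?_⟩
  have hx0 : 0 ≤ x := by linarith
  have hs0 : 0 < s := hs
  have hD0 : 0 < D := hD
  have hφ : (0 : ℝ) < Nat.totient s := by exact_mod_cast Nat.totient_pos.2 hs0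
  have hDs : D.Coprime s := coprime_of_isCoprime_mul hsa
  have hsa' : IsCoprime (s : ℤ) a := hsa.of_mul_right_left
  have hx1 : (1 : ℝ) ≤ x ^ (1 / 100 : ℝ) := Real.one_le_rpow hx (by norm_num)
  have hM₁1 : 1 ≤ M₁ := hx1.trans hM₁
  have hM₂1 : 1 ≤ M₂ := hM₁1.trans h12
  set B₁ := (Ioc ⌊lo₁⌋₊ ⌊hi₁⌋₊).filter (fun m : ℕ => (m : ZMod D) = (t₁ : ZMod D))
  set B₂ := (Ioc ⌊lo₂⌋₊ ⌊hi₂⌋₊).filter (fun m : ℕ => (m : ZMod D) = (t₂ : ZMod D))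
  set B₃ := (Ioc ⌊lo₃⌋₊ ⌊hi₃⌋₊).filter (fun m : ℕ => (m : ZMod D) = (t₃ : ZMod D))
  have hK0 : 0 ≤ 1 + (σ 0 s : ℝ) / (Nat.totient s : ℝ) := by positivity
  -- Step 1: count in `m₃`, triangle inequality in `m₂`, `m₁`
  have hinner : ∀ m₁ m₂ : ℕ, |∑ m₃ ∈ B₃, gAP s a (m₁ * m₂ * m₃)| ≤
      1 + (σ 0 s : ℝ) / (Nat.totient s : ℝ) := fun m₁ m₂ =>
    abs_sum_apBox_gAP_mul_le hs0 hD0 hDs hsa' (m₁ * m₂) t₃ ⌊lo₃⌋₊ ⌊hi₃⌋₊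
  have h2 : ∀ m₁ : ℕ, |∑ m₂ ∈ B₂, ∑ m₃ ∈ B₃, gAP s a (m₁ * m₂ * m₃)| ≤
      (B₂.card : ℝ) * (1 + (σ 0 s : ℝ) / (Nat.totient s : ℝ)) := fun m₁ => by
    calc _ ≤ ∑ m₂ ∈ B₂, |∑ m₃ ∈ B₃, gAP s a (m₁ * m₂ * m₃)| := Finset.abs_sum_le_sum_abs _ _
      _ ≤ ∑ _m₂ ∈ B₂, (1 + (σ 0 s : ℝ) / (Nat.totient s : ℝ)) :=
          Finset.sum_le_sum fun m₂ _ => hinner m₁ m₂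
      _ = (B₂.card : ℝ) * (1 + (σ 0 s : ℝ) / (Nat.totient s : ℝ)) := by
          rw [Finset.sum_const, nsmul_eq_mul]
  have h1 : |∑ m₁ ∈ B₁, ∑ m₂ ∈ B₂, ∑ m₃ ∈ B₃, gAP s a (m₁ * m₂ * m₃)| ≤
      (B₁.card : ℝ) * ((B₂.card : ℝ) * (1 + (σ 0 s : ℝ) / (Nat.totient s : ℝ))) := by
    calc _ ≤ ∑ m₁ ∈ B₁, |∑ m₂ ∈ B₂, ∑ m₃ ∈ B₃, gAP s a (m₁ * m₂ * m₃)| :=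
          Finset.abs_sum_le_sum_abs _ _
      _ ≤ ∑ _m₁ ∈ B₁, (B₂.card : ℝ) * (1 + (σ 0 s : ℝ) / (Nat.totient s : ℝ)) :=
          Finset.sum_le_sum fun m₁ _ => h2 m₁
      _ = (B₁.card : ℝ) * ((B₂.card : ℝ) * (1 + (σ 0 s : ℝ) / (Nat.totient s : ℝ))) := by
          rw [Finset.sum_const, nsmul_eq_mul]
  -- Step 2: sizes
  have hc₁ : (B₁.card : ℝ) ≤ 2 * M₁ := card_apBox_le_two_mul hM₁1 hlo₁ hhi₁ D t₁
  have hc₂ : (B₂.card : ℝ) ≤ 2 * M₂ := card_apBox_le_two_mul hM₂1 hlo₂ hhi₂ D t₂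
  have hP : M₁ * M₂ ≤ x ^ (2 / 3 : ℝ) :=
    mul_le_rpow_two_thirds (zero_le_one.trans hM₁1) (zero_le_one.trans hM₂1) (h12.trans h23) h23 hx0
      hprod
  have hτφ := one_add_card_divisors_div_totient_le hs0 hsx
  have hexp : x ^ (2 / 3 : ℝ) * x ^ θ = x ^ (1 - (1 / 3 - θ)) := by
    rw [← Real.rpow_add (by linarith)]
    congr 1
    ring
  -- Step 3: assemble
  rw [Real.rpow_zero, mul_one]
  calc |∑ m₁ ∈ B₁, ∑ m₂ ∈ B₂, ∑ m₃ ∈ B₃, gAP s a (m₁ * m₂ * m₃)|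
      ≤ (B₁.card : ℝ) * ((B₂.card : ℝ) * (1 + (σ 0 s : ℝ) / (Nat.totient s : ℝ))) := h1
    _ ≤ (2 * M₁) * ((2 * M₂) * (2 * x ^ θ / (Nat.totient s : ℝ))) :=
        mul_le_mul hc₁ (mul_le_mul hc₂ hτφ hK0 (by positivity)) (by positivity) (by positivity)
    _ = 8 * (M₁ * M₂) * x ^ θ / (Nat.totient s : ℝ) := by ring
    _ ≤ 8 * x ^ (2 / 3 : ℝ) * x ^ θ / (Nat.totient s : ℝ) := by gcongr
    _ = 8 * x ^ (1 - (1 / 3 - θ)) / (Nat.totient s : ℝ) := by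
        rw [← hexp]
        ring

/-- **Lemma 4.12 ((4.16)) in the trivial range**: the statement of the named fact
`FouvryTenenbaum2021_lemma412` verbatim, the level `x^{3/5}` being replaced by `x^θ` for an arbitrary
`θ < 1/2` — unconditionally, with `δ = 1/2 − θ`, `C₀ = 0`, `C = 4`:
`|∑_{m₁,m₂}| ≤ #box₁ · (1 + τ(s)/φ(s)) ≤ 2M₁ · 2s/φ(s) ≤ 4 x^{1/2+θ}/φ(s)` (`M₁² ≤ M₁M₂ ≤ x`).
The range `x^{1/2} ≤ s ≤ x^{3/5}` (Weil's bound for Kloosterman sums) is NOT proved here.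
[cite: FouvryTenenbaum2021, Lemma 4.12 (trivial range)] -/
theorem FouvryTenenbaum2021_lemma412_smallLevel {θ : ℝ} (hθ : θ < 1 / 2) :
    ∃ δ C₀ C : ℝ, 0 < δ ∧ ∀ x : ℝ, 1 ≤ x → ∀ M₁ M₂ lo₁ hi₁ lo₂ hi₂ : ℝ,
      x ^ (1 / 100 : ℝ) ≤ M₁ → M₁ ≤ M₂ → M₁ * M₂ ≤ x →
      M₁ ≤ lo₁ → hi₁ ≤ 2 * M₁ → M₂ ≤ lo₂ → hi₂ ≤ 2 * M₂ →
      ∀ (s D : ℕ) (a t₁ t₂ : ℤ), 1 ≤ s → (s : ℝ) ≤ x ^ θ → 1 ≤ D →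
        IsCoprime (s : ℤ) (a * D) → IsCoprime (t₁ * t₂) (D : ℤ) →
        |∑ m₁ ∈ (Ioc ⌊lo₁⌋₊ ⌊hi₁⌋₊).filter (fun m : ℕ => (m : ZMod D) = (t₁ : ZMod D)),
            ∑ m₂ ∈ (Ioc ⌊lo₂⌋₊ ⌊hi₂⌋₊).filter (fun m : ℕ => (m : ZMod D) = (t₂ : ZMod D)),
              gAP s a (m₁ * m₂)| ≤
          C * (D : ℝ) ^ C₀ * x ^ (1 - δ) / (Nat.totient s : ℝ) := by
  refine ⟨1 / 2 - θ, 0, 4, by linarith, fun x hx M₁ M₂ lo₁ hi₁ lo₂ hi₂ hM₁ h12 hprod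
    hlo₁ hhi₁ _ _ s D a t₁ t₂ hs hsx hD hsa _ => ?_⟩
  have hx0 : 0 ≤ x := by linarith
  have hs0 : 0 < s := hs
  have hD0 : 0 < D := hD
  have hφ : (0 : ℝ) < Nat.totient s := by exact_mod_cast Nat.totient_pos.2 hs0
  have hDs : D.Coprime s := coprime_of_isCoprime_mul hsa
  have hsa' : IsCoprime (s : ℤ) a := hsa.of_mul_right_left
  have hx1 : (1 : ℝ) ≤ x ^ (1 / 100 : ℝ) := Real.one_le_rpow hx (by norm_num)
  have hM₁1 : 1 ≤ M₁ := hx1.trans hM₁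
  set B₁ := (Ioc ⌊lo₁⌋₊ ⌊hi₁⌋₊).filter (fun m : ℕ => (m : ZMod D) = (t₁ : ZMod D))
  set B₂ := (Ioc ⌊lo₂⌋₊ ⌊hi₂⌋₊).filter (fun m : ℕ => (m : ZMod D) = (t₂ : ZMod D))
  have hK0 : 0 ≤ 1 + (σ 0 s : ℝ) / (Nat.totient s : ℝ) := by positivity
  have hinner : ∀ m₁ : ℕ, |∑ m₂ ∈ B₂, gAP s a (m₁ * m₂)| ≤ 1 + (σ 0 s : ℝ) / (Nat.totient s : ℝ) :=
    fun m₁ => abs_sum_apBox_gAP_mul_le hs0 hD0 hDs hsa' m₁ t₂ ⌊lo₂⌋₊ ⌊hi₂⌋₊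
  have h1 : |∑ m₁ ∈ B₁, ∑ m₂ ∈ B₂, gAP s a (m₁ * m₂)| ≤
      (B₁.card : ℝ) * (1 + (σ 0 s : ℝ) / (Nat.totient s : ℝ)) := by
    calc _ ≤ ∑ m₁ ∈ B₁, |∑ m₂ ∈ B₂, gAP s a (m₁ * m₂)| := Finset.abs_sum_le_sum_abs _ _
      _ ≤ ∑ _m₁ ∈ B₁, (1 + (σ 0 s : ℝ) / (Nat.totient s : ℝ)) :=
          Finset.sum_le_sum fun m₁ _ => hinner m₁
      _ = (B₁.card : ℝ) * (1 + (σ 0 s : ℝ) / (Nat.totient s : ℝ)) := by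
          rw [Finset.sum_const, nsmul_eq_mul]
  have hc₁ : (B₁.card : ℝ) ≤ 2 * M₁ := card_apBox_le_two_mul hM₁1 hlo₁ hhi₁ D t₁
  -- `M₁ ≤ x^{1/2}` from `M₁² ≤ M₁ M₂ ≤ x`
  have hP : M₁ ≤ x ^ (1 / 2 : ℝ) := by
    have hM0 : 0 ≤ M₁ := zero_le_one.trans hM₁1
    have hsq : M₁ ^ 2 ≤ x := by nlinarith
    calc M₁ = (M₁ ^ 2) ^ (((2 : ℕ) : ℝ)⁻¹) := (Real.pow_rpow_inv_natCast hM0 (by norm_num)).symm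
      _ ≤ x ^ (((2 : ℕ) : ℝ)⁻¹) := Real.rpow_le_rpow (pow_nonneg hM0 _) hsq (by positivity)
      _ = x ^ (1 / 2 : ℝ) := by norm_num
  have hτφ := one_add_card_divisors_div_totient_le hs0 hsx
  have hexp : x ^ (1 / 2 : ℝ) * x ^ θ = x ^ (1 - (1 / 2 - θ)) := by
    rw [← Real.rpow_add (by linarith)]
    congr 1
    ring
  rw [Real.rpow_zero, mul_one]
  calc |∑ m₁ ∈ B₁, ∑ m₂ ∈ B₂, gAP s a (m₁ * m₂)|
      ≤ (B₁.card : ℝ) * (1 + (σ 0 s : ℝ) / (Nat.totient s : ℝ)) := h1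
    _ ≤ (2 * M₁) * (2 * x ^ θ / (Nat.totient s : ℝ)) := mul_le_mul hc₁ hτφ hK0 (by positivity)
    _ = 4 * M₁ * x ^ θ / (Nat.totient s : ℝ) := by ring
    _ ≤ 4 * x ^ (1 / 2 : ℝ) * x ^ θ / (Nat.totient s : ℝ) := by gcongr
    _ = 4 * x ^ (1 - (1 / 2 - θ)) / (Nat.totient s : ℝ) := by
        rw [← hexp]
        ring


/-! ## The Weil range: Lemma 4.12 at every level `θ < 2/3`, Lemma 4.13 up to level `x^{4/9}`

Both from the completion estimate `FouvryTenenbaum2021.lemma412_core` of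
`FouvryTenenbaumDivisorAPWeilProofs.lean` (Weil's bound for Kloosterman sums, PROVED in the tree):
`|∑_{m₁ ≡ t₁} ∑_{m₂ ≡ t₂} g_s(m₁m₂; a)| ≤ τ(s)(1 + log s)((N₁ + 1)/s + τ(s) √s (1 + log s) + N₁/φ(s))`,
`N₁ = R₁ − L₁` the length of the first range. -/

namespace FouvryTenenbaum2021

/-- `τ(s)(1 + log s) ≤ C_τ (1 + 1/η) s^{2η}` from the divisor bound `τ(s) ≤ C_τ s^η` and
`log s ≤ s^η/η`. [folklore] -/
theorem card_divisors_mul_log_le {η Cτ : ℝ} (hη : 0 < η)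
    (hCτ : ∀ n : ℕ, n ≠ 0 → ((Nat.divisors n).card : ℝ) ≤ Cτ * (n : ℝ) ^ η) {s : ℕ} (hs : 0 < s) :
    ((Nat.divisors s).card : ℝ) * (1 + Real.log s) ≤ Cτ * (1 + 1 / η) * (s : ℝ) ^ (2 * η) := by
  have hsR : (0 : ℝ) < s := by exact_mod_cast hs
  have hs1 : (1 : ℝ) ≤ s := by exact_mod_cast hs
  have hτ : ((Nat.divisors s).card : ℝ) ≤ Cτ * (s : ℝ) ^ η := hCτ s hs.ne'
  have hL : 1 + Real.log s ≤ (1 + 1 / η) * (s : ℝ) ^ η := by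
    have h1 : Real.log s ≤ (s : ℝ) ^ η / η := Real.log_le_rpow_div hsR.le hη
    have h2 : (1 : ℝ) ≤ (s : ℝ) ^ η := Real.one_le_rpow hs1 hη.le
    have h3 : (1 + 1 / η) * (s : ℝ) ^ η = (s : ℝ) ^ η + (s : ℝ) ^ η / η := by ring
    rw [h3]; linarith
  have hlog : 0 ≤ 1 + Real.log s := by
    have := Real.log_nonneg hs1; linarith
  have hCτ0 : 0 ≤ Cτ * (s : ℝ) ^ η := (Nat.cast_nonneg _).trans hτ
  calc ((Nat.divisors s).card : ℝ) * (1 + Real.log s)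
      ≤ (Cτ * (s : ℝ) ^ η) * ((1 + 1 / η) * (s : ℝ) ^ η) := mul_le_mul hτ hL hlog hCτ0
    _ = Cτ * (1 + 1 / η) * ((s : ℝ) ^ η * (s : ℝ) ^ η) := by ring
    _ = Cτ * (1 + 1 / η) * (s : ℝ) ^ (2 * η) := by rw [← Real.rpow_add hsR]; ring_nf

/-- The bracket of `lemma412_core` in the form used below: for `N ≥ 0`,
`(N + 1)/s + T + N/φ(s) ≤ 2(N + 1)/φ(s) + T` (`φ(s) ≤ s`). [folklore] -/
theorem core_bracket_le {s : ℕ} (hs : 0 < s) {N : ℝ} (hN : 0 ≤ N) (T : ℝ) :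
    (N + 1) / s + T + N / Nat.totient s ≤ 2 * (N + 1) / Nat.totient s + T := by
  have hφ : (0 : ℝ) < Nat.totient s := by exact_mod_cast Nat.totient_pos.2 hs
  have hφs : (Nat.totient s : ℝ) ≤ s := by exact_mod_cast Nat.totient_le s
  have h1 : (N + 1) / s ≤ (N + 1) / Nat.totient s := div_le_div_of_nonneg_left (by linarith) hφ hφs
  have h2 : N / Nat.totient s ≤ (N + 1) / Nat.totient s :=
    div_le_div_of_nonneg_right (by linarith) hφ.le
  have h3 : 2 * (N + 1) / (Nat.totient s : ℝ) = (N + 1) / Nat.totient s + (N + 1) / Nat.totient s := by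
    ring
  rw [h3]; linarith

/-- The endgame exponent inequality: `s^{4η + 1/2} φ(s) ≤ x^{θ(4η + 3/2)}` for `1 ≤ s ≤ x^θ`, `x ≥ 1`,
`η ≥ 0`. [folklore] -/
theorem rpow_mul_totient_le {s : ℕ} (hs : 0 < s) {x θ η : ℝ} (hx : 1 ≤ x) (hsx : (s : ℝ) ≤ x ^ θ)
    (hη : 0 ≤ η) :
    (s : ℝ) ^ (4 * η + 1 / 2) * (Nat.totient s : ℝ) ≤ x ^ (θ * (4 * η + 3 / 2)) := by
  have hsR : (0 : ℝ) < s := by exact_mod_cast hs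
  have hx0 : 0 < x := by linarith
  have hφs : (Nat.totient s : ℝ) ≤ s := by exact_mod_cast Nat.totient_le s
  calc (s : ℝ) ^ (4 * η + 1 / 2) * (Nat.totient s : ℝ)
      ≤ (s : ℝ) ^ (4 * η + 1 / 2) * (s : ℝ) ^ (1 : ℝ) := by
        rw [Real.rpow_one]; gcongr
    _ = (s : ℝ) ^ (4 * η + 3 / 2) := by rw [← Real.rpow_add hsR]; ring_nf
    _ ≤ (x ^ θ) ^ (4 * η + 3 / 2) := Real.rpow_le_rpow hsR.le hsx (by positivity)
    _ = x ^ (θ * (4 * η + 3 / 2)) := by rw [← Real.rpow_mul hx0.le]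

/-! ### Three variables: the Weil-range bound for (4.18) -/

/-- **The Weil-range bound for three variables** (the `τ₂`-estimate in `(m₂, m₃)` for each `m₁`): for
`s, D ≥ 1`, `(D, s) = (a, s) = 1`, any first range, `L₂ ≤ R₂`, any third range and classes,
`|∑_{m₁} ∑_{m₂} ∑_{m₃} g_s(m₁m₂m₃; a)| ≤ #box₁ · τ(s)(1 + log s)((N₂ + 1)/s + τ(s) √s (1 + log s) + N₂/φ(s))`,
`N₂ = R₂ − L₂`: for `(m₁, s) = 1`, `g_s(m₁m₂m₃; a) = g_s(m₂m₃; a m̄₁)` and `lemma412_core` applies in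
the class `a m̄₁`; for `(m₁, s) > 1` the terms vanish.  This is the shape of the first auxiliary
estimate of Heath-Brown's proof of (4.18) (Acta Arith. 47 (1986), p. 32: "The two auxilliary estimates
are dealt with in Sections 5 and 6. The first of these is straightforward, and uses Weil's bound for the
ordinary Kloosterman sum."). [cite: FouvryTenenbaum2021, Lemma 4.13 (Weil range)] -/
theorem abs_sum_apBox3_gAP_le {s D : ℕ} [NeZero s] (hD : 0 < D) (hDs : D.Coprime s) {a : ℤ}
    (ha : IsCoprime (s : ℤ) a) (A₁ B₁ : ℕ) {L₂ R₂ : ℕ} (hLR : L₂ ≤ R₂) (A₃ B₃ : ℕ) (t₁ t₂ t₃ : ℤ) :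
    |∑ m₁ ∈ (Ioc A₁ B₁).filter (fun m : ℕ => (m : ZMod D) = (t₁ : ZMod D)),
        ∑ m₂ ∈ (Ioc L₂ R₂).filter (fun m : ℕ => (m : ZMod D) = (t₂ : ZMod D)),
          ∑ m₃ ∈ (Ioc A₃ B₃).filter (fun m : ℕ => (m : ZMod D) = (t₃ : ZMod D)),
            gAP s a (m₁ * m₂ * m₃)| ≤
      (((Ioc A₁ B₁).filter (fun m : ℕ => (m : ZMod D) = (t₁ : ZMod D))).card : ℝ) *
        ((Nat.divisors s).card * (1 + Real.log s) *
          ((((R₂ : ℝ) - L₂) + 1) / s + (Nat.divisors s).card * Real.sqrt s * (1 + Real.log s) +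
            ((R₂ : ℝ) - L₂) / Nat.totient s)) := by
  have hs : 0 < s := Nat.pos_of_ne_zero (NeZero.ne s)
  set box₁ := (Ioc A₁ B₁).filter (fun m : ℕ => (m : ZMod D) = (t₁ : ZMod D))
  set box₂ := (Ioc L₂ R₂).filter (fun m : ℕ => (m : ZMod D) = (t₂ : ZMod D)) with hbox₂
  set box₃ := (Ioc A₃ B₃).filter (fun m : ℕ => (m : ZMod D) = (t₃ : ZMod D)) with hbox₃
  set W : ℝ := (Nat.divisors s).card * (1 + Real.log s) *
    ((((R₂ : ℝ) - L₂) + 1) / s + (Nat.divisors s).card * Real.sqrt s * (1 + Real.log s) +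
      ((R₂ : ℝ) - L₂) / Nat.totient s) with hW
  -- each `m₁`
  have hinner : ∀ m₁ : ℕ, |∑ m₂ ∈ box₂, ∑ m₃ ∈ box₃, gAP s a (m₁ * m₂ * m₃)| ≤ W := by
    intro m₁
    by_cases hm₁ : m₁.Coprime s
    · set b : ℤ := ((((a : ZMod s) * ((m₁ : ZMod s))⁻¹).val : ℕ) : ℤ) with hb_def
      have hb : (b : ZMod s) = (a : ZMod s) * ((m₁ : ZMod s))⁻¹ := by
        simp only [b, Int.cast_natCast, ZMod.natCast_zmod_val]
      have hbu : IsUnit ((b : ℤ) : ZMod s) := by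
        rw [hb]
        exact ((ZMod.coe_int_isUnit_iff_isCoprime a s).2 ha).mul
          (IsUnit.of_mul_eq_one_right _ (ZMod.coe_mul_inv_eq_one m₁ hm₁))
      have hrw : ∑ m₂ ∈ box₂, ∑ m₃ ∈ box₃, gAP s a (m₁ * m₂ * m₃) =
          ∑ m₂ ∈ box₂, ∑ m₃ ∈ box₃, gAP s b (m₂ * m₃) := by
        refine Finset.sum_congr rfl fun m₂ _ => Finset.sum_congr rfl fun m₃ _ => ?_
        rw [mul_assoc, gAP_mul_left_of_coprime hm₁ hb]
      rw [hrw, hW, hbox₂, hbox₃]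
      exact lemma412_core hD hDs hbu hLR A₃ B₃ t₂ t₃
    · have hzero : ∑ m₂ ∈ box₂, ∑ m₃ ∈ box₃, gAP s a (m₁ * m₂ * m₃) = 0 := by
        refine Finset.sum_eq_zero fun m₂ _ => Finset.sum_eq_zero fun m₃ _ => ?_
        rw [mul_assoc, gAP_mul_left_eq_zero hm₁ ha]
      rw [hzero, abs_zero, hW]
      have hlog : 0 ≤ 1 + Real.log s := by
        have := Real.log_nonneg (show (1 : ℝ) ≤ s by exact_mod_cast hs); linarith
      have hN : (0 : ℝ) ≤ (R₂ : ℝ) - L₂ := by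
        have : (L₂ : ℝ) ≤ R₂ := by exact_mod_cast hLR
        linarith
      positivity
  calc |∑ m₁ ∈ box₁, ∑ m₂ ∈ box₂, ∑ m₃ ∈ box₃, gAP s a (m₁ * m₂ * m₃)|
      ≤ ∑ m₁ ∈ box₁, |∑ m₂ ∈ box₂, ∑ m₃ ∈ box₃, gAP s a (m₁ * m₂ * m₃)| := Finset.abs_sum_le_sum_abs _ _
    _ ≤ ∑ _m₁ ∈ box₁, W := Finset.sum_le_sum fun m₁ _ => hinner m₁
    _ = (box₁.card : ℝ) * W := by rw [Finset.sum_const, nsmul_eq_mul]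

end FouvryTenenbaum2021

/-! ### Lemma 4.12 at every level `θ < 2/3` -/

open FouvryTenenbaum2021

/-- **Fouvry–Tenenbaum 2021, Lemma 4.12 ((4.16)) at every level `θ < 2/3` — PROVED**: the statement of
the named fact `FouvryTenenbaum2021_lemma412` with `x^{3/5}` replaced by `x^θ`, for any `θ < 2/3` — the
printed generality "for each `ε > 0` … `1 ≤ q ≤ x^{2/3−ε}`" of (4.16), of which the named fact (proved as
`FouvryTenenbaum2021_lemma412_holds` in `FouvryTenenbaumDivisorAPWeilProofs.lean`) is the case
`ε = 1/15`.  Constants: `δ = min(2/3 − θ, 1/10)`, `C₀ = 0`, `C = 6K + K²` with `K = C_τ (1 + 1/η)`,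
`η = δ/8`, `C_τ` the constant of the divisor bound `τ(n) ≤ C_τ n^η`: by `lemma412_core`,
`|∑| ≤ τ(s)(1 + log s)(6 x^{1/2}/φ(s) + τ(s) √s (1 + log s)) ≤ (6K x^{1/2+2η} + K² s^{3/2+4η})/φ(s)` and
`s^{3/2+4η} ≤ x^{θ(3/2+4η)} ≤ x^{1−δ}`. [cite: FouvryTenenbaum2021, Lemma 4.12] -/
theorem FouvryTenenbaum2021_lemma412_of_lt {θ : ℝ} (hθ : θ < 2 / 3) :
    ∃ δ C₀ C : ℝ, 0 < δ ∧ ∀ x : ℝ, 1 ≤ x → ∀ M₁ M₂ lo₁ hi₁ lo₂ hi₂ : ℝ,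
      x ^ (1 / 100 : ℝ) ≤ M₁ → M₁ ≤ M₂ → M₁ * M₂ ≤ x →
      M₁ ≤ lo₁ → hi₁ ≤ 2 * M₁ → M₂ ≤ lo₂ → hi₂ ≤ 2 * M₂ →
      ∀ (s D : ℕ) (a t₁ t₂ : ℤ), 1 ≤ s → (s : ℝ) ≤ x ^ θ → 1 ≤ D →
        IsCoprime (s : ℤ) (a * D) → IsCoprime (t₁ * t₂) (D : ℤ) →
        |∑ m₁ ∈ (Ioc ⌊lo₁⌋₊ ⌊hi₁⌋₊).filter (fun m : ℕ => (m : ZMod D) = (t₁ : ZMod D)),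
            ∑ m₂ ∈ (Ioc ⌊lo₂⌋₊ ⌊hi₂⌋₊).filter (fun m : ℕ => (m : ZMod D) = (t₂ : ZMod D)),
              gAP s a (m₁ * m₂)| ≤
          C * (D : ℝ) ^ C₀ * x ^ (1 - δ) / (Nat.totient s : ℝ) := by
  -- the constants
  set δ : ℝ := min (2 / 3 - θ) (1 / 10) with hδ
  have hδ0 : 0 < δ := lt_min (by linarith) (by norm_num)
  have hδ1 : δ ≤ 1 / 10 := min_le_right _ _
  have hδ2 : δ ≤ 2 / 3 - θ := min_le_left _ _
  set η : ℝ := δ / 8 with hη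
  have hη0 : 0 < η := by positivity
  obtain ⟨Cτ, hCτ1, hCτ⟩ := exists_card_divisors_le_mul_rpow hη0
  set K : ℝ := Cτ * (1 + 1 / η) with hK
  have hK0 : 0 ≤ K := by rw [hK]; have := zero_le_one.trans hCτ1; positivity
  refine ⟨δ, 0, 6 * K + K ^ 2, hδ0, fun x hx M₁ M₂ lo₁ hi₁ lo₂ hi₂ hM₁ h12 hprod hlo₁ hhi₁ _ _
    s D a t₁ t₂ hs hsx hD hsa _ => ?_⟩
  haveI : NeZero s := ⟨by omega⟩
  have hx0 : 0 < x := by linarith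
  have hs0 : 0 < s := hs
  have hsR : (0 : ℝ) < s := by exact_mod_cast hs0
  have hD0 : 0 < D := hD
  have hφ : (0 : ℝ) < Nat.totient s := by exact_mod_cast Nat.totient_pos.2 hs0
  have hDs : D.Coprime s := coprime_of_isCoprime_mul hsa
  have ha : IsUnit ((a : ℤ) : ZMod s) := (ZMod.coe_int_isUnit_iff_isCoprime a s).2 hsa.of_mul_right_left
  have hx1 : (1 : ℝ) ≤ x ^ (1 / 100 : ℝ) := Real.one_le_rpow hx (by norm_num)
  have hM₁1 : 1 ≤ M₁ := hx1.trans hM₁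
  rw [Real.rpow_zero, mul_one]
  have hRHS0 : 0 ≤ (6 * K + K ^ 2) * x ^ (1 - δ) / (Nat.totient s : ℝ) := by positivity
  rcases lt_or_ge ⌊hi₁⌋₊ ⌊lo₁⌋₊ with hlt | hAB
  · rw [Finset.Ioc_eq_empty (not_lt.mpr hlt.le), Finset.filter_empty, Finset.sum_empty, abs_zero]
    exact hRHS0
  refine (lemma412_core hD0 hDs ha hAB ⌊lo₂⌋₊ ⌊hi₂⌋₊ t₁ t₂).trans ?_
  -- the length of the first range, and the bracket
  set N : ℝ := (⌊hi₁⌋₊ : ℝ) - ⌊lo₁⌋₊ with hN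
  have hN0 : 0 ≤ N := by
    have : (⌊lo₁⌋₊ : ℝ) ≤ ⌊hi₁⌋₊ := by exact_mod_cast hAB
    rw [hN]; linarith
  have hN1 : N + 1 ≤ 3 * x ^ (1 / 2 : ℝ) := by
    have h1 : N ≤ M₁ + 1 := lemma412_floor_sub_floor_le (zero_le_one.trans hM₁1) hlo₁ hhi₁
    have hP : M₁ ≤ x ^ (1 / 2 : ℝ) := by
      have hM0 : 0 ≤ M₁ := zero_le_one.trans hM₁1
      have hsq : M₁ ^ 2 ≤ x := by nlinarith
      calc M₁ = (M₁ ^ 2) ^ (((2 : ℕ) : ℝ)⁻¹) := (Real.pow_rpow_inv_natCast hM0 (by norm_num)).symm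
        _ ≤ x ^ (((2 : ℕ) : ℝ)⁻¹) := Real.rpow_le_rpow (pow_nonneg hM0 _) hsq (by positivity)
        _ = x ^ (1 / 2 : ℝ) := by norm_num
    have : (1 : ℝ) ≤ x ^ (1 / 2 : ℝ) := Real.one_le_rpow hx (by norm_num)
    linarith
  have hτL : ((Nat.divisors s).card : ℝ) * (1 + Real.log s) ≤ K * (s : ℝ) ^ (2 * η) :=
    card_divisors_mul_log_le hη0 hCτ hs0
  have hτL0 : 0 ≤ ((Nat.divisors s).card : ℝ) * (1 + Real.log s) := by
    have := Real.log_nonneg (show (1 : ℝ) ≤ s by exact_mod_cast hs); positivity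
  have hsx1 : (s : ℝ) ≤ x := by
    refine hsx.trans ?_
    calc x ^ θ ≤ x ^ (1 : ℝ) := Real.rpow_le_rpow_of_exponent_le hx (by linarith)
      _ = x := Real.rpow_one x
  have hs2η : (s : ℝ) ^ (2 * η) ≤ x ^ (2 * η) := Real.rpow_le_rpow hsR.le hsx1 (by positivity)
  -- the two terms
  have hT1 : ((Nat.divisors s).card : ℝ) * (1 + Real.log s) * (2 * (N + 1) / (Nat.totient s)) ≤
      6 * K * x ^ (1 - δ) / (Nat.totient s) := by
    have hexp : x ^ (2 * η) * x ^ (1 / 2 : ℝ) ≤ x ^ (1 - δ) := by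
      rw [← Real.rpow_add hx0]
      exact Real.rpow_le_rpow_of_exponent_le hx (by linarith)
    calc ((Nat.divisors s).card : ℝ) * (1 + Real.log s) * (2 * (N + 1) / (Nat.totient s))
        ≤ (K * (s : ℝ) ^ (2 * η)) * (2 * (3 * x ^ (1 / 2 : ℝ)) / (Nat.totient s)) := by
          apply mul_le_mul hτL _ (div_nonneg (by linarith) hφ.le) (by positivity)
          apply div_le_div_of_nonneg_right _ hφ.le; linarith
      _ ≤ (K * x ^ (2 * η)) * (2 * (3 * x ^ (1 / 2 : ℝ)) / (Nat.totient s)) := by gcongr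
      _ = 6 * K * (x ^ (2 * η) * x ^ (1 / 2 : ℝ)) / (Nat.totient s) := by ring
      _ ≤ 6 * K * x ^ (1 - δ) / (Nat.totient s) := by gcongr
  have hT2 : ((Nat.divisors s).card : ℝ) * (1 + Real.log s) *
      (((Nat.divisors s).card : ℝ) * Real.sqrt s * (1 + Real.log s)) ≤
      K ^ 2 * x ^ (1 - δ) / (Nat.totient s) := by
    have h1 : ((Nat.divisors s).card : ℝ) * (1 + Real.log s) *
        (((Nat.divisors s).card : ℝ) * Real.sqrt s * (1 + Real.log s)) ≤
        K ^ 2 * (s : ℝ) ^ (4 * η + 1 / 2) := by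
      calc ((Nat.divisors s).card : ℝ) * (1 + Real.log s) *
            (((Nat.divisors s).card : ℝ) * Real.sqrt s * (1 + Real.log s))
          = (((Nat.divisors s).card : ℝ) * (1 + Real.log s)) *
              (((Nat.divisors s).card : ℝ) * (1 + Real.log s)) * Real.sqrt s := by ring
        _ ≤ (K * (s : ℝ) ^ (2 * η)) * (K * (s : ℝ) ^ (2 * η)) * Real.sqrt s := by
            apply mul_le_mul_of_nonneg_right _ (Real.sqrt_nonneg _)
            exact mul_le_mul hτL hτL hτL0 (by positivity)
        _ = K ^ 2 * ((s : ℝ) ^ (2 * η) * (s : ℝ) ^ (2 * η) * (s : ℝ) ^ (1 / 2 : ℝ)) := by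
            rw [Real.sqrt_eq_rpow]; ring
        _ = K ^ 2 * (s : ℝ) ^ (4 * η + 1 / 2) := by
            rw [← Real.rpow_add hsR, ← Real.rpow_add hsR]; ring_nf
    have hexp : θ * (4 * η + 3 / 2) ≤ 1 - δ := by
      rcases lt_or_ge θ 0 with hθ0 | hθ0
      · have : θ * (4 * η + 3 / 2) ≤ 0 := mul_nonpos_of_nonpos_of_nonneg hθ0.le (by positivity)
        linarith
      · have : θ * η ≤ 2 / 3 * η := mul_le_mul_of_nonneg_right hθ.le hη0.le
        nlinarith
    have h2 : (s : ℝ) ^ (4 * η + 1 / 2) * (Nat.totient s : ℝ) ≤ x ^ (1 - δ) :=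
      (rpow_mul_totient_le hs0 hx hsx hη0.le).trans (Real.rpow_le_rpow_of_exponent_le hx hexp)
    have h3 : (s : ℝ) ^ (4 * η + 1 / 2) ≤ x ^ (1 - δ) / (Nat.totient s : ℝ) := by
      rw [le_div_iff₀ hφ]; exact h2
    calc _ ≤ K ^ 2 * (s : ℝ) ^ (4 * η + 1 / 2) := h1
      _ ≤ K ^ 2 * (x ^ (1 - δ) / (Nat.totient s : ℝ)) := by gcongr
      _ = K ^ 2 * x ^ (1 - δ) / (Nat.totient s) := by ring
  -- assemble
  calc ((Nat.divisors s).card : ℝ) * (1 + Real.log s) *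
        ((N + 1) / s + ((Nat.divisors s).card : ℝ) * Real.sqrt s * (1 + Real.log s) + N / Nat.totient s)
      ≤ ((Nat.divisors s).card : ℝ) * (1 + Real.log s) *
        (2 * (N + 1) / Nat.totient s + ((Nat.divisors s).card : ℝ) * Real.sqrt s * (1 + Real.log s)) :=
        mul_le_mul_of_nonneg_left (core_bracket_le hs0 hN0 _) hτL0
    _ = ((Nat.divisors s).card : ℝ) * (1 + Real.log s) * (2 * (N + 1) / (Nat.totient s)) +
        ((Nat.divisors s).card : ℝ) * (1 + Real.log s) *
          (((Nat.divisors s).card : ℝ) * Real.sqrt s * (1 + Real.log s)) := by ring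
    _ ≤ 6 * K * x ^ (1 - δ) / (Nat.totient s) + K ^ 2 * x ^ (1 - δ) / (Nat.totient s) :=
        add_le_add hT1 hT2
    _ = (6 * K + K ^ 2) * x ^ (1 - δ) / (Nat.totient s : ℝ) := by ring

/-! ### Lemma 4.13 up to level `x^{4/9}` -/

set_option maxHeartbeats 400000 in
/-- **Lemma 4.13 ((4.18)) in the Weil range**: the statement of the named fact
`FouvryTenenbaum2021_lemma413` VERBATIM, the level `x^{1/2+1/85}` being replaced by `x^θ` for an arbitrary
`θ < 4/9` — unconditionally (this supersedes `FouvryTenenbaum2021_lemma413_smallLevel`, `θ < 1/3`), with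
`δ = min(4/9 − θ, 1/10)`, `C₀ = 0`, `C = 12K + 2K²` (`K = C_τ(1 + 1/η)`, `η = δ/8`): by
`abs_sum_apBox3_gAP_le`, `|∑| ≤ 2M₁ · τ(s)(1 + log s)(6M₂/φ(s) + τ(s) √s (1 + log s))`, and
`M₁M₂ ≤ x^{2/3}`, `M₁ ≤ x^{1/3}`, `s^{3/2+4η} ≤ x^{θ(3/2+4η)}`, `1/3 + θ(3/2 + 4η) ≤ 1 − δ`.  In the critical
case `M₁ ≈ M₂ ≈ M₃ ≈ x^{1/3}` Weil's bound alone does not go further; the range `x^{4/9} ≤ s ≤ x^{1/2+1/85}`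
of the named fact is Heath-Brown's theorem (Deligne's bounds) and is NOT proved in the tree.
[cite: FouvryTenenbaum2021, Lemma 4.13 (Weil range)] -/
theorem FouvryTenenbaum2021_lemma413_of_lt {θ : ℝ} (hθ : θ < 4 / 9) :
    ∃ δ C₀ C : ℝ, 0 < δ ∧ ∀ x : ℝ, 1 ≤ x → ∀ M₁ M₂ M₃ lo₁ hi₁ lo₂ hi₂ lo₃ hi₃ : ℝ,
      x ^ (1 / 100 : ℝ) ≤ M₁ → M₁ ≤ M₂ → M₂ ≤ M₃ → M₁ * M₂ * M₃ ≤ x →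
      M₁ ≤ lo₁ → hi₁ ≤ 2 * M₁ → M₂ ≤ lo₂ → hi₂ ≤ 2 * M₂ → M₃ ≤ lo₃ → hi₃ ≤ 2 * M₃ →
      ∀ (s D : ℕ) (a t₁ t₂ t₃ : ℤ), 1 ≤ s → (s : ℝ) ≤ x ^ θ → 1 ≤ D →
        IsCoprime (s : ℤ) (a * D) → IsCoprime (t₁ * t₂ * t₃) (D : ℤ) →
        |∑ m₁ ∈ (Ioc ⌊lo₁⌋₊ ⌊hi₁⌋₊).filter (fun m : ℕ => (m : ZMod D) = (t₁ : ZMod D)),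
            ∑ m₂ ∈ (Ioc ⌊lo₂⌋₊ ⌊hi₂⌋₊).filter (fun m : ℕ => (m : ZMod D) = (t₂ : ZMod D)),
              ∑ m₃ ∈ (Ioc ⌊lo₃⌋₊ ⌊hi₃⌋₊).filter (fun m : ℕ => (m : ZMod D) = (t₃ : ZMod D)),
                gAP s a (m₁ * m₂ * m₃)| ≤
          C * (D : ℝ) ^ C₀ * x ^ (1 - δ) / (Nat.totient s : ℝ) := by
  -- the constants
  set δ : ℝ := min (4 / 9 - θ) (1 / 10) with hδ
  have hδ0 : 0 < δ := lt_min (by linarith) (by norm_num)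
  have hδ1 : δ ≤ 1 / 10 := min_le_right _ _
  have hδ2 : δ ≤ 4 / 9 - θ := min_le_left _ _
  set η : ℝ := δ / 8 with hη
  have hη0 : 0 < η := by positivity
  obtain ⟨Cτ, hCτ1, hCτ⟩ := exists_card_divisors_le_mul_rpow hη0
  set K : ℝ := Cτ * (1 + 1 / η) with hK
  have hK0 : 0 ≤ K := by rw [hK]; have := zero_le_one.trans hCτ1; positivity
  refine ⟨δ, 0, 12 * K + 2 * K ^ 2, hδ0, fun x hx M₁ M₂ M₃ lo₁ hi₁ lo₂ hi₂ lo₃ hi₃ hM₁ h12 h23 hprod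
    hlo₁ hhi₁ hlo₂ hhi₂ _ _ s D a t₁ t₂ t₃ hs hsx hD hsa _ => ?_⟩
  haveI : NeZero s := ⟨by omega⟩
  have hx0 : 0 < x := by linarith
  have hs0 : 0 < s := hs
  have hsR : (0 : ℝ) < s := by exact_mod_cast hs0
  have hD0 : 0 < D := hD
  have hφ : (0 : ℝ) < Nat.totient s := by exact_mod_cast Nat.totient_pos.2 hs0
  have hDs : D.Coprime s := coprime_of_isCoprime_mul hsa
  have hsa' : IsCoprime (s : ℤ) a := hsa.of_mul_right_left
  have hx1 : (1 : ℝ) ≤ x ^ (1 / 100 : ℝ) := Real.one_le_rpow hx (by norm_num)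
  have hM₁1 : 1 ≤ M₁ := hx1.trans hM₁
  have hM₂1 : 1 ≤ M₂ := hM₁1.trans h12
  rw [Real.rpow_zero, mul_one]
  have hRHS0 : 0 ≤ (12 * K + 2 * K ^ 2) * x ^ (1 - δ) / (Nat.totient s : ℝ) := by positivity
  rcases lt_or_ge ⌊hi₂⌋₊ ⌊lo₂⌋₊ with hlt | hLR
  · rw [Finset.Ioc_eq_empty (not_lt.mpr hlt.le), Finset.filter_empty]
    simp only [Finset.sum_empty, Finset.sum_const_zero, abs_zero]
    exact hRHS0
  refine (abs_sum_apBox3_gAP_le hD0 hDs hsa' ⌊lo₁⌋₊ ⌊hi₁⌋₊ hLR ⌊lo₃⌋₊ ⌊hi₃⌋₊ t₁ t₂ t₃).trans ?_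
  -- sizes
  have hc₁ : ((((Ioc ⌊lo₁⌋₊ ⌊hi₁⌋₊).filter (fun m : ℕ => (m : ZMod D) = (t₁ : ZMod D))).card : ℕ) : ℝ)
      ≤ 2 * M₁ := card_apBox_le_two_mul hM₁1 hlo₁ hhi₁ D t₁
  set N : ℝ := (⌊hi₂⌋₊ : ℝ) - ⌊lo₂⌋₊ with hN
  have hN0 : 0 ≤ N := by
    have : (⌊lo₂⌋₊ : ℝ) ≤ ⌊hi₂⌋₊ := by exact_mod_cast hLR
    rw [hN]; linarith
  have hN1 : N + 1 ≤ 3 * M₂ := by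
    have h1 : N ≤ M₂ + 1 := lemma412_floor_sub_floor_le (zero_le_one.trans hM₂1) hlo₂ hhi₂
    linarith
  have hM12 : M₁ * M₂ ≤ x ^ (2 / 3 : ℝ) :=
    mul_le_rpow_two_thirds (zero_le_one.trans hM₁1) (zero_le_one.trans hM₂1) (h12.trans h23) h23 hx0.le
      hprod
  have hM₁3 : M₁ ≤ x ^ (1 / 3 : ℝ) := by
    have hM0 : 0 ≤ M₁ := zero_le_one.trans hM₁1
    have hcube : M₁ ^ 3 ≤ x := by
      calc M₁ ^ 3 = M₁ * M₁ * M₁ := by ring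
        _ ≤ M₁ * M₂ * M₃ := by
          apply mul_le_mul (mul_le_mul_of_nonneg_left h12 hM0) (h12.trans h23) hM0
          exact mul_nonneg hM0 (zero_le_one.trans hM₂1)
        _ ≤ x := hprod
    calc M₁ = (M₁ ^ 3) ^ (((3 : ℕ) : ℝ)⁻¹) := (Real.pow_rpow_inv_natCast hM0 (by norm_num)).symm
      _ ≤ x ^ (((3 : ℕ) : ℝ)⁻¹) := Real.rpow_le_rpow (pow_nonneg hM0 _) hcube (by positivity)
      _ = x ^ (1 / 3 : ℝ) := by norm_num
  have hτL : ((Nat.divisors s).card : ℝ) * (1 + Real.log s) ≤ K * (s : ℝ) ^ (2 * η) :=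
    card_divisors_mul_log_le hη0 hCτ hs0
  have hτL0 : 0 ≤ ((Nat.divisors s).card : ℝ) * (1 + Real.log s) := by
    have := Real.log_nonneg (show (1 : ℝ) ≤ s by exact_mod_cast hs); positivity
  have hsx1 : (s : ℝ) ≤ x := by
    refine hsx.trans ?_
    calc x ^ θ ≤ x ^ (1 : ℝ) := Real.rpow_le_rpow_of_exponent_le hx (by linarith)
      _ = x := Real.rpow_one x
  have hs2η : (s : ℝ) ^ (2 * η) ≤ x ^ (2 * η) := Real.rpow_le_rpow hsR.le hsx1 (by positivity)
  -- the two terms (for one `m₁`, times `2M₁`)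
  have hT1 : 2 * M₁ * (((Nat.divisors s).card : ℝ) * (1 + Real.log s) * (2 * (N + 1) / (Nat.totient s))) ≤
      12 * K * x ^ (1 - δ) / (Nat.totient s) := by
    have hexp : x ^ (2 * η) * x ^ (2 / 3 : ℝ) ≤ x ^ (1 - δ) := by
      rw [← Real.rpow_add hx0]
      exact Real.rpow_le_rpow_of_exponent_le hx (by linarith)
    calc 2 * M₁ * (((Nat.divisors s).card : ℝ) * (1 + Real.log s) * (2 * (N + 1) / (Nat.totient s)))
        ≤ 2 * M₁ * ((K * (s : ℝ) ^ (2 * η)) * (2 * (3 * M₂) / (Nat.totient s))) := by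
          apply mul_le_mul_of_nonneg_left _ (by linarith)
          apply mul_le_mul hτL _ (div_nonneg (by linarith) hφ.le) (by positivity)
          apply div_le_div_of_nonneg_right _ hφ.le; linarith
      _ ≤ 2 * M₁ * ((K * x ^ (2 * η)) * (2 * (3 * M₂) / (Nat.totient s))) := by gcongr
      _ = 12 * K * (x ^ (2 * η) * (M₁ * M₂)) / (Nat.totient s) := by ring
      _ ≤ 12 * K * (x ^ (2 * η) * x ^ (2 / 3 : ℝ)) / (Nat.totient s) := by gcongr
      _ ≤ 12 * K * x ^ (1 - δ) / (Nat.totient s) := by gcongr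
  have hT2 : 2 * M₁ * (((Nat.divisors s).card : ℝ) * (1 + Real.log s) *
      (((Nat.divisors s).card : ℝ) * Real.sqrt s * (1 + Real.log s))) ≤
      2 * K ^ 2 * x ^ (1 - δ) / (Nat.totient s) := by
    have h1 : ((Nat.divisors s).card : ℝ) * (1 + Real.log s) *
        (((Nat.divisors s).card : ℝ) * Real.sqrt s * (1 + Real.log s)) ≤
        K ^ 2 * (s : ℝ) ^ (4 * η + 1 / 2) := by
      calc ((Nat.divisors s).card : ℝ) * (1 + Real.log s) *
            (((Nat.divisors s).card : ℝ) * Real.sqrt s * (1 + Real.log s))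
          = (((Nat.divisors s).card : ℝ) * (1 + Real.log s)) *
              (((Nat.divisors s).card : ℝ) * (1 + Real.log s)) * Real.sqrt s := by ring
        _ ≤ (K * (s : ℝ) ^ (2 * η)) * (K * (s : ℝ) ^ (2 * η)) * Real.sqrt s := by
            apply mul_le_mul_of_nonneg_right _ (Real.sqrt_nonneg _)
            exact mul_le_mul hτL hτL hτL0 (by positivity)
        _ = K ^ 2 * ((s : ℝ) ^ (2 * η) * (s : ℝ) ^ (2 * η) * (s : ℝ) ^ (1 / 2 : ℝ)) := by
            rw [Real.sqrt_eq_rpow]; ring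
        _ = K ^ 2 * (s : ℝ) ^ (4 * η + 1 / 2) := by
            rw [← Real.rpow_add hsR, ← Real.rpow_add hsR]; ring_nf
    have hexp : 1 / 3 + θ * (4 * η + 3 / 2) ≤ 1 - δ := by
      rcases lt_or_ge θ 0 with hθ0 | hθ0
      · have : θ * (4 * η + 3 / 2) ≤ 0 := mul_nonpos_of_nonpos_of_nonneg hθ0.le (by positivity)
        linarith
      · have : θ * η ≤ 4 / 9 * η := mul_le_mul_of_nonneg_right hθ.le hη0.le
        nlinarith
    have h2 : x ^ (1 / 3 : ℝ) * ((s : ℝ) ^ (4 * η + 1 / 2) * (Nat.totient s : ℝ)) ≤ x ^ (1 - δ) := by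
      calc x ^ (1 / 3 : ℝ) * ((s : ℝ) ^ (4 * η + 1 / 2) * (Nat.totient s : ℝ))
          ≤ x ^ (1 / 3 : ℝ) * x ^ (θ * (4 * η + 3 / 2)) := by
            gcongr; exact rpow_mul_totient_le hs0 hx hsx hη0.le
        _ = x ^ (1 / 3 + θ * (4 * η + 3 / 2)) := by rw [← Real.rpow_add hx0]
        _ ≤ x ^ (1 - δ) := Real.rpow_le_rpow_of_exponent_le hx hexp
    have h3 : x ^ (1 / 3 : ℝ) * (s : ℝ) ^ (4 * η + 1 / 2) ≤ x ^ (1 - δ) / (Nat.totient s : ℝ) := by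
      rw [le_div_iff₀ hφ]
      calc x ^ (1 / 3 : ℝ) * (s : ℝ) ^ (4 * η + 1 / 2) * (Nat.totient s : ℝ)
          = x ^ (1 / 3 : ℝ) * ((s : ℝ) ^ (4 * η + 1 / 2) * (Nat.totient s : ℝ)) := by ring
        _ ≤ x ^ (1 - δ) := h2
    calc 2 * M₁ * (((Nat.divisors s).card : ℝ) * (1 + Real.log s) *
          (((Nat.divisors s).card : ℝ) * Real.sqrt s * (1 + Real.log s)))
        ≤ 2 * x ^ (1 / 3 : ℝ) * (K ^ 2 * (s : ℝ) ^ (4 * η + 1 / 2)) := by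
          apply mul_le_mul _ h1 (mul_nonneg hτL0 (by positivity)) (by positivity)
          linarith
      _ = 2 * K ^ 2 * (x ^ (1 / 3 : ℝ) * (s : ℝ) ^ (4 * η + 1 / 2)) := by ring
      _ ≤ 2 * K ^ 2 * (x ^ (1 - δ) / (Nat.totient s : ℝ)) := by gcongr
      _ = 2 * K ^ 2 * x ^ (1 - δ) / (Nat.totient s) := by ring
  -- assemble
  have hbr := core_bracket_le hs0 hN0 (((Nat.divisors s).card : ℝ) * Real.sqrt s * (1 + Real.log s))
  calc ((((Ioc ⌊lo₁⌋₊ ⌊hi₁⌋₊).filter (fun m : ℕ => (m : ZMod D) = (t₁ : ZMod D))).card : ℕ) : ℝ) *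
        (((Nat.divisors s).card : ℝ) * (1 + Real.log s) *
          ((N + 1) / s + ((Nat.divisors s).card : ℝ) * Real.sqrt s * (1 + Real.log s) + N / Nat.totient s))
      ≤ (2 * M₁) * (((Nat.divisors s).card : ℝ) * (1 + Real.log s) *
          (2 * (N + 1) / Nat.totient s + ((Nat.divisors s).card : ℝ) * Real.sqrt s * (1 + Real.log s))) := by
        have hbr0 : 0 ≤ (N + 1) / s + ((Nat.divisors s).card : ℝ) * Real.sqrt s * (1 + Real.log s) +
            N / Nat.totient s := by
          have hlog : 0 ≤ 1 + Real.log s := by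
            have := Real.log_nonneg (show (1 : ℝ) ≤ s by exact_mod_cast hs); linarith
          have h1 : 0 ≤ (N + 1) / s := div_nonneg (by linarith) hsR.le
          have h2 : 0 ≤ N / Nat.totient s := div_nonneg hN0 hφ.le
          have h3 : 0 ≤ ((Nat.divisors s).card : ℝ) * Real.sqrt s * (1 + Real.log s) := by positivity
          linarith
        have hM0 : 0 ≤ 2 * M₁ := by linarith
        exact mul_le_mul hc₁ (mul_le_mul_of_nonneg_left hbr hτL0) (mul_nonneg hτL0 hbr0) hM0
    _ = 2 * M₁ * (((Nat.divisors s).card : ℝ) * (1 + Real.log s) * (2 * (N + 1) / (Nat.totient s))) +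
        2 * M₁ * (((Nat.divisors s).card : ℝ) * (1 + Real.log s) *
          (((Nat.divisors s).card : ℝ) * Real.sqrt s * (1 + Real.log s))) := by ring
    _ ≤ 12 * K * x ^ (1 - δ) / (Nat.totient s) + 2 * K ^ 2 * x ^ (1 - δ) / (Nat.totient s) :=
        add_le_add hT1 hT2
    _ = (12 * K + 2 * K ^ 2) * x ^ (1 - δ) / (Nat.totient s : ℝ) := by ring


/-! ### The tuple forms `DivisorAPTuple 1 θ` (`θ < 2/3`) and `DivisorAPTuple 2 θ` (`θ < 4/9`), unconditionally -/

/-- **`DivisorAPTuple 1 θ` for every `θ < 2/3`, unconditionally** (the tuple form of Lemma 4.12 used by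
the consumers, re-indexed from `FouvryTenenbaum2021_lemma412_of_lt` exactly as `divisorAPTuple_one` is
from the named fact). [cite: FouvryTenenbaum2021, Lemma 4.12] -/
theorem FouvryTenenbaum2021.divisorAPTuple_one_of_lt {θ : ℝ} (hθ : θ < 2 / 3) : DivisorAPTuple 1 θ := by
  obtain ⟨δ, C₀, C, hδ, H⟩ := FouvryTenenbaum2021_lemma412_of_lt hθ
  refine ⟨δ, max C₀ 0, max C 0, hδ, le_max_right _ _, le_max_right _ _,
    fun x hx M lo hi Ml lol hil _ hMl hM1 _ hprod hlo hhi hlol hhil s D a t tl hs hsx hD hsa ht htl => ?_⟩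
  have hx0 : 0 ≤ x := by linarith
  have hprod' : M 0 * Ml ≤ x := by rwa [Fin.prod_univ_one] at hprod
  have key := H x hx (M 0) Ml (lo 0) (hi 0) lol hil (hM1 0) (hMl 0) hprod' (hlo 0) (hhi 0) hlol hhil
    s D a (t 0) tl hs hsx hD hsa ((ht 0).mul_left htl)
  have hsum : ∑ m ∈ piFinset (fun i => apBox (lo i) (hi i) D (t i)), ∑ n ∈ apBox lol hil D tl,
        gAP s a ((∏ i, m i) * n) =
      ∑ m₁ ∈ apBox (lo 0) (hi 0) D (t 0), ∑ n ∈ apBox lol hil D tl, gAP s a (m₁ * n) := by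
    refine Finset.sum_equiv (Equiv.funUnique (Fin 1) ℕ) (fun m => ?_) (fun m _ => ?_)
    · simp only [Fintype.mem_piFinset, Equiv.funUnique_apply, Fin.forall_fin_one, Fin.default_eq_zero]
    · simp
  rw [hsum]
  exact key.trans (bound_mono hD hx0)

/-- **`DivisorAPTuple 1 (3/5)`, unconditionally** (`divisorAPTuple_one` fed with the discharge
`FouvryTenenbaum2021_lemma412_holds` of `FouvryTenenbaumDivisorAPWeilProofs.lean`).
[cite: FouvryTenenbaum2021, Lemma 4.12] -/
theorem FouvryTenenbaum2021.divisorAPTuple_one_holds : DivisorAPTuple 1 (3 / 5) :=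
  divisorAPTuple_one FouvryTenenbaum2021_lemma412_holds

/-- **`DivisorAPTuple 2 θ` for every `θ < 4/9`, unconditionally** (the tuple form of Lemma 4.13 in the
Weil range, re-indexed from `FouvryTenenbaum2021_lemma413_of_lt` exactly as `divisorAPTuple_two` is from
the named fact; the level `1/2 + 1/85` of `divisorAPTuple_two` still rests on the unproved named fact
`FouvryTenenbaum2021_lemma413` — Deligne's bounds). [cite: FouvryTenenbaum2021, Lemma 4.13 (Weil range)] -/
theorem FouvryTenenbaum2021.divisorAPTuple_two_of_lt {θ : ℝ} (hθ : θ < 4 / 9) : DivisorAPTuple 2 θ := by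
  obtain ⟨δ, C₀, C, hδ, H⟩ := FouvryTenenbaum2021_lemma413_of_lt hθ
  refine ⟨δ, max C₀ 0, max C 0, hδ, le_max_right _ _, le_max_right _ _,
    fun x hx M lo hi Ml lol hil hM hMl hM1 _ hprod hlo hhi hlol hhil s D a t tl hs hsx hD hsa ht htl => ?_⟩
  have hx0 : 0 ≤ x := by linarith
  have hprod' : M 0 * M 1 * Ml ≤ x := by rwa [Fin.prod_univ_two] at hprod
  have h01 : M 0 ≤ M 1 := hM (by decide)
  have key := H x hx (M 0) (M 1) Ml (lo 0) (hi 0) (lo 1) (hi 1) lol hil (hM1 0) h01 (hMl 1) hprod'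
    (hlo 0) (hhi 0) (hlo 1) (hhi 1) hlol hhil s D a (t 0) (t 1) tl hs hsx hD hsa
    (((ht 0).mul_left (ht 1)).mul_left htl)
  have hsum : ∑ m ∈ piFinset (fun i => apBox (lo i) (hi i) D (t i)), ∑ n ∈ apBox lol hil D tl,
        gAP s a ((∏ i, m i) * n) =
      ∑ m₁ ∈ apBox (lo 0) (hi 0) D (t 0), ∑ m₂ ∈ apBox (lo 1) (hi 1) D (t 1),
        ∑ n ∈ apBox lol hil D tl, gAP s a (m₁ * m₂ * n) := by
    rw [← Finset.sum_product' (s := apBox (lo 0) (hi 0) D (t 0)) (t := apBox (lo 1) (hi 1) D (t 1))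
      (f := fun m₁ m₂ => ∑ n ∈ apBox lol hil D tl, gAP s a (m₁ * m₂ * n))]
    refine Finset.sum_equiv (finTwoArrowEquiv ℕ) (fun m => ?_) (fun m _ => ?_)
    · simp only [Fintype.mem_piFinset, Fin.forall_fin_two, Finset.mem_product]
      rfl
    · simp [Fin.prod_univ_two]
  rw [hsum]
  exact key.trans (bound_mono hD hx0)

end Literature.NumberTheory.Sieve

end
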